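import Mathlib
import HarnessLib
import Summits.NavierStokesRegularity.NavierStokesRegularity.Theorems.PoloidalWindowDoorPoloidalWindowRigidityVorticityTranslate
import Summits.NavierStokesRegularity.NavierStokesRegularity.Theorems.PoloidalWindowDoorPoloidalWindowRigidityVorticityAxisymmetricSlice

/-!
# Route `PoloidalWindowDoor`, crux `PoloidalWindowRigidity` (K2, stmt-NavierStokesRegularity-19708) — ASSEMBLY of the transfer
# «a horizontal Killing symmetry of the vorticity on one slice ⇒ not backward-singular» (the target of conjecture LRC′)

Cell ns-regularity-ideate, seat ns-poloidal-K2-p1 gen 3 (K2 lead; helper `--supports` the crux).  The seat's jet-level probe (memo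
K2P1-LOCAL-NOTES v6) supports the corrected local-rigidity conjecture LRC′: a poloidal Navier–Stokes flow with non-degenerate Clebsch slope
has, on each slice, VORTICITY invariant under a one-parameter group of horizontal isometries — translations along a horizontal line
(stratum (A)) or rotations about a vertical axis (stratum (A′)), the axis being allowed to move in time.  This file records, as ONE
theorem in the exact vocabulary of the crux, that EITHER alternative on ONE slice already settles the profile:

* `nonflatLiouville_of_slice_vorticity_symmetry` — a profile of the route's Type-I class, poloidal along `e₃`, one slice `s < 0` of
  which has vorticity invariant under all translations along some `e ≠ 0` (K2-p3 `…VorticityTranslate`, one slice) OR axisymmetric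
  about the vertical axis through some centre `c` (this seat's `…VorticityAxisymmetricSlice`, one slice, any axis), is not
  backward-singular at `(0,0)`.

So the proposed line «lrc-jet» (HOME/ns-poloidal-K2-p1/LINE-PROPOSAL-lrc-jet.md) reduces the residue `stub_residueSupercriticalNearPeak`
to LRC′ plus the Λ-degenerate bookkeeping; nothing else of the transfer is missing in the tree.
WHAT THIS IS NOT: not a claim about Navier–Stokes regularity, not LRC′ and not the residue — an assembly of settled strata. [folklore]
-/

noncomputable section

-- the summit and its single sub-problem share the name (CONVENTIONS §1), as in every Theorems file
set_option linter.dupNamespace false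

namespace Summit.NavierStokesRegularity.NavierStokesRegularity.Theorems.PoloidalWindowDoorPoloidalWindowRigiditySliceSymmetryReduction

open Set Function InnerProductSpace
open scoped RealInnerProductSpace InnerProductSpace
open Literature.Analysis Literature.Analysis.FluidPDE
open Summit.NavierStokesRegularity.NavierStokesRegularity.Theorems.PoloidalWindowDoorPoloidalWindowRigidityVorticityTranslate
open Summit.NavierStokesRegularity.NavierStokesRegularity.Theorems.PoloidalWindowDoorPoloidalWindowRigidityVorticityAxisymmetricSlice

variable {C : ℝ} {v : ℝ → EuclideanSpace ℝ (Fin 3) → EuclideanSpace ℝ (Fin 3)}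

/-- **A horizontal Killing symmetry of the vorticity on ONE slice settles the poloidal residue.**  For a profile of the route's
Type-I class, poloidal along `e₃`: if some slice `s < 0` has vorticity invariant under the translations along some `e ≠ 0`, or
axisymmetric about the vertical axis through some `c`, then `(0,0)` is not a backward singular point. -/
theorem nonflatLiouville_of_slice_vorticity_symmetry (hrate : HasTypeITimeDecay C v)
    (hcont : ContinuousOn (uncurry v) (Iio (0 : ℝ) ×ˢ univ))
    (hmild : ∀ s t : ℝ, s < t → t < 0 → ∀ x,
      v t x = UnboundedOperators.heatExtension (v s) (t - s) x - oseenDuhamel 1 s v v t x)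
    (hdiv : ∀ t < 0, VectorCalculus.IsDivFree (v t))
    (hpol : ∀ s < 0, ∀ y, ⟪curl (v s) y, EuclideanSpace.single 2 1⟫_ℝ = 0)
    (hsym : ∃ s < 0,
      (∃ e : EuclideanSpace ℝ (Fin 3), e ≠ 0 ∧ ∀ (y : EuclideanSpace ℝ (Fin 3)) (l : ℝ), curl (v s) (y + l • e) = curl (v s) y) ∨
      (∃ c : EuclideanSpace ℝ (Fin 3), IsAxisymmetric (curl (fun y => v s (y + c))))) :
    ¬ IsBackwardSingularPoint v 0 := by
  obtain ⟨s, hs, h⟩ := hsym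
  rcases h with ⟨e, he, htr⟩ | ⟨c, haxi⟩
  · exact nonflatLiouville_of_curl_translate_eq_slice hrate hcont hmild hdiv hs he htr
  · exact nonflatLiouville_of_curl_axisymmetric_slice hrate hcont hmild hdiv hpol hs c haxi

end Summit.NavierStokesRegularity.NavierStokesRegularity.Theorems.PoloidalWindowDoorPoloidalWindowRigiditySliceSymmetryReduction

end
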